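/-
Copyright: lit-balaban Phase-2 proof seat p08 (gen 8).  Statement-level skeleton of a published paper; no proof claims beyond what
the kernel checks below.
-/
import Literature.MathematicalPhysics.QuantumFieldTheory.BalabanImbrieJaffe1984to88.BIJ88Decay223CkTorus
import Literature.MathematicalPhysics.QuantumFieldTheory.BalabanImbrieJaffe1984to88.BIJ88Cutoffs21

/-!
# `BalabanImbrieJaffe1984to88.BIJ88CkLoc226Torus` — T. Bałaban, J. Imbrie, A. Jaffe, *Effective action and cluster properties of the
abelian Higgs model*, Commun. Math. Phys. **114** (1988) 257–315 [BalabanImbrieJaffe1988]: **(2.24)–(2.26)** p. 262 — the LOCALIZED kernel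
`C_{k,loc}(x,b′) = ζ′_k(x,b′)C_k(x,b′)` (2.25) OF THE `C_k` OF RECORD on the tori of the series (seat p08 g7's `BIJ88Eq220Torus.CkE P hd η_k^d
L^k k`, (2.22) verbatim), with the cutoff `ζ′_k` of (2.24) CONSTRUCTED by seat p13 (`BIJ88Cutoffs21.cutoff (r/4) (r/2) dist`): *"Then C_{k,loc}
also satisfies (2.23)"* and **(2.26)** *"|C_{k,loc}(x,b′) − C_k(x,b′)| ≦ e^{−cr(e_k)}e^{−c dist(x,b′)}"* PROVED ON THE TORI GIVEN ONLY [6I]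
PROPOSITION 1.2 BY ITS TREE NAME — from p08 g8's (2.23) for `C_k` (`BIJ88Decay223CkTorus.decay223_Ck_torus_prop12`, three-constant form;
`decayFar223_Ck_torus_prop12`, r18's typed one-letter `DecayFar` in a rescaled distance) and seat p02's (2.26) mechanism
(`BIJ88Close218Proof.close226`)

statement-level skeleton of published theorems with citation tags; proofs where landed; nothing here is a claim about the Yang–Mills mass gap

PDF held: `paper:balaban1988-cmp114-bij-abelian-higgs-effective-action` (journal page = PDF page + 256), p. 262 [PDF 6] (text layer
`~/.lit/texts/paper-balaban1988-cmp114-bij-abelian-higgs-effective-action/p0006.txt`, re-read this session); [6I] = [Balaban1984PropagatorsI]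
Prop. 1.2 (tree name `Balaban1983to89.B5.Prop12Printed`).

CITATION HEADER (lean-in-tree rule).  Part of the lit-balaban TYPED SKELETON (HOME `run/shared/lean/pub/lit-balaban/`), Phase-2 proof
seat p08 (gen 8), unit `lit-balaban-p08`; WHAT IS REPRODUCED = SKELETON rows **C2.Eq2.25** (DEF, reader file `HOME/lit-balaban-r18/ROWS-C2.md`,
owner r18, referee ref-5: *"typed p239939"*, decl `BIJ88Sect2Statements.loc`) and **C2.Eq2.26** (*"proved p248140 (p02 g3)"*: the abstract
mechanism `close226` from the one-letter (2.23) `DecayFar` + (2.24) `Zeta224`), kind «model instance for the operator of record»: both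
sentences instantiated at `C_k = CkE` on the tori with the (7.2.2)/(7.2.3)/(7.2.4) inputs discharged down to `B5.Prop12Printed` (rows
C1.Eq7.2.1-7.2.2 / 7.2.3 / 7.2.4, C2.Eq2.23: `BIJ88Decay223CkTorus`); row **C2.Eq2.24** (p13 g6 p254195 `BIJ88Cutoffs21`: `cutoff`,
`zeta224_cutoff`, `cutoff_mem_Icc`, `isCutoff_cutoff`, `abs_loc_cutoff_le`) supplies `ζ′_k`.  TAKING line HOME/STATUS.md (gen 8, after
18:55Z).  Decls used BY NAME (nothing restated): r18's typed `BIJ88Sect2Statements.loc` / `Close` / `DecayFar` / `IsCutoff` / `Zeta224`;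
p02's `BIJ88Close218Proof.close226`; p13's `BIJ88Cutoffs21.*`; p08's `BIJ88Decay223CkTorus.decay223_Ck_torus_prop12` /
`decayFar223_Ck_torus_prop12`.

THE PRINTED TEXT (p. 262 [PDF 6], verbatim): *"Of course there is no uniform bound on ∂C_k. The localized version of C_k is defined using
another smooth cutoff: ζ′_k(x,b′) = 1, for dist(x,b′) ≦ ¼r(e_k), 0, for dist(x,b′) ≧ ½r(e_k). (2.24) We then construct C_{k,loc} on T_η^{(k)}
from C_k on T_η^{(k)}: C_{k,loc}(x,b′) = C_k(x,b′)ζ′_k(x,b′). (2.25) Then C_{k,loc} also satisfies (2.23) and |C_{k,loc}(x,b′) − C_k(x,b′)| ≦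
e^{−cr(e_k)}e^{−c dist(x,b′)}. (2.26)"*.

THE TORUS DATA (all in the tree): as in `BIJ88Decay223CkTorus` — `C_k(x,b′) := (CkE P hd η_k^d L^k k e_{b′})(x)` for fine sites
`x ∈ T_η = TSite P 0` and unit bonds `b′ ∈ T₁^{(k)*} = PBond P k`, `dist(x,b′) := distEU P k x b′₋ = |x − ctr_k(b′₋)|_∞/L^k`; the cutoff
`ζ′_k := cutoff (r/4) (r/2) dist` of p13 at a radius parameter `r` (print: `r = r(e_k)` of (2.3)); `C_{k,loc} := loc ζ′_k C_k` (r18's (2.25)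
`loc ζ K a b = ζ a b · K a b`).

WHAT IS PROVED (0 `sorry`, standard axioms; theorems only — proof lane; every `d ≥ 2`):
* §1 THE MECHANISM IN THE THREE-CONSTANT SHAPE (any carrier): `abs_loc_le_of_unit` (`0 ≤ ζ ≤ 1 ⇒ |loc ζ K| ≤ |K|`),
  **`decay3_loc`** (*"C_{k,loc} also satisfies (2.23)"*: a decay `c₀e^{−δ′dist}` beyond `R₀` is inherited by `loc ζ K`),
  **`close_loc_of_decay3`** ((2.26): if `ζ = 1` within `R₁ ≥ R₀` and `0 ≤ ζ ≤ 1`, then `Close dist (loc ζ K) K (c₀e^{−(δ′/2)R₁}) (δ′/2)` —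
  p02's `close_loc_of_decayFar` with threshold, prefactor and rate kept apart).
* §2 ON THE TORI FOR THE `C_k` OF RECORD, GIVEN ONLY `B5.Prop12Printed` (`levStd` torus family): **`decay223_CkLoc_torus_prop12`**
  (`∃ R₀ c₀ δ′, 0 < δ′ ∧ 0 ≤ c₀ ∧ ∀ k ≤ m + K, ∀ r, ∀ x b′, R₀ ≤ dist(x,b′) → |C_{k,loc}(x,b′)| ≤ c₀e^{−δ′dist(x,b′)}` — ONE triple for all
  scales and all radii `r`), **`close226_torus_prop12`** (`∃ R₀ c₀ δ′, … ∀ k ≤ m + K, ∀ r ≥ 4R₀ (r > 0):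
  Close dist C_{k,loc} C_k (c₀e^{−(δ′/2)(r/4)}) (δ′/2)` — (2.26) with `e^{−cr(e_k)} = e^{−(δ′/8)r}` at the printed radii `r/4 < r/2`),
  **`close226_torus_prop12_typed`** (p02's one-letter `close226` fed with `decayFar223_Ck_torus_prop12`: `∃ κ > 0, c > 0, ∀ k ≤ m + K,
  ∀ r ≥ 4c, Close (κ·dist) (loc ζ′ C_k) C_k (ce^{−(c/2)(r/4)}) (c/2)` with `ζ′ = cutoff (r/4) (r/2) (κ·dist)` — the row's typed shape for the
  kernel of record, radii in the rescaled distance), `zeta224_torus` (the cutoff used IS a (2.24) cutoff: r18's `Zeta224`).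
HONEST SCOPE.  (i) The one remaining hypothesis is [6I] Proposition 1.2 BY NAME; constants existential per torus `P`, uniform in `k ≤ m + K`
and in the radius `r`.  (ii) The radius `r` is a free parameter (print: `r = r(e_k) = |log e_k⁻¹|^r` of (2.3), large for small `e_k` — the
condition `r ≥ 4R₀` is the print's *"dist(x,b′) > c"* regime); `dist` as in the (2.23) file; the typed one-letter form lives in the rescaled
distance `κ·dist`.  (iii) `U = 1`, real abelian fields, torus, standing range; smoothness of `ζ′_k` in `x` is p13's `contDiff_cutoffProfile`
composed with the distance and is not used here.  (iv) No `def`, no new named fact, nothing restated; NOT summit progress.  Unit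
`lit-balaban-p08` (literature-prover-lit-balaban-p08-g8-0), 2026-08-21.
-/

open scoped BigOperators RealInnerProductSpace

namespace Literature.MathematicalPhysics.QuantumFieldTheory.BalabanImbrieJaffe1984to88.BIJ88CkLoc226Torus

open Balaban1983to89 hiding Site Plaq
open Balaban1983to89.LatticeFieldCalculus
open BIJ85AxialPropagator411 BIJ85Prop521Torus BIJ85Sigma421Torus BIJ85Prop522Torus BIJ85Sigma422Eta
open BIJ85Sect7Statements BIJ85Ineq722Torus
open BIJ85Ineq722DeltaA (deltaAData)
open BIJ85Ineq722ProofPart2 (settingOf)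
open BIJ88Sect2Statements (DecayFar Close IsCutoff Zeta224 loc)
open BIJ88Close218Proof (close226)
open BIJ88Cutoffs21 (cutoff cutoff_nonneg cutoff_le_one isCutoff_cutoff zeta224_cutoff)
open BIJ88Eq220Torus (CkE)
open BIJ88Decay223CkTorus (decay223_Ck_torus_prop12 decayFar223_Ck_torus_prop12)

open Balaban1983to89 renaming Site → TSite, Plaq → TPlaq

noncomputable section

variable {P : Params}

/-! ## §1  The mechanism in the three-constant shape -/

section Mechanism

variable {α β : Type*}

/-- localization by a cutoff with values in `[0,1]` never increases a kernel: `|ζK| ≤ |K|` ((2.25) with (2.24)).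
[cite: BalabanImbrieJaffe1988, (2.25) p.262] -/
theorem abs_loc_le_of_unit {ζ K : α → β → ℝ} (h01 : ∀ a b, 0 ≤ ζ a b ∧ ζ a b ≤ 1) (a : α) (b : β) :
    |loc ζ K a b| ≤ |K a b| := by
  rw [loc, abs_mul, abs_of_nonneg (h01 a b).1]
  exact mul_le_of_le_one_left (abs_nonneg _) (h01 a b).2

/-- **"Then C_{k,loc} also satisfies (2.23)"** in the three-constant shape: if `|K(a,b)| ≤ c₀e^{−δ′dist(a,b)}` whenever `dist(a,b) ≥ R₀`
and `0 ≤ ζ ≤ 1`, then the same holds for `loc ζ K`. [cite: BalabanImbrieJaffe1988, (2.25) p.262] -/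
theorem decay3_loc {dist : α → β → ℝ} {ζ K : α → β → ℝ} {R₀ c₀ δ' : ℝ} (h01 : ∀ a b, 0 ≤ ζ a b ∧ ζ a b ≤ 1)
    (hK : ∀ a b, R₀ ≤ dist a b → |K a b| ≤ c₀ * Real.exp (-δ' * dist a b)) (a : α) (b : β) (hab : R₀ ≤ dist a b) :
    |loc ζ K a b| ≤ c₀ * Real.exp (-δ' * dist a b) :=
  (abs_loc_le_of_unit h01 a b).trans (hK a b hab)

/-- **(2.26) in the three-constant shape**: if `|K(a,b)| ≤ c₀e^{−δ′dist(a,b)}` for `dist(a,b) ≥ R₀` (`c₀, δ′ ≥ 0`), `ζ = 1` within `R₁`,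
`R₀ ≤ R₁`, and `0 ≤ ζ ≤ 1`, then `|loc ζ K − K| ≤ (c₀e^{−(δ′/2)R₁})·e^{−(δ′/2)dist}` — inside `R₁` the difference vanishes, outside
`|(ζ − 1)K| ≤ |K| ≤ c₀e^{−δ′D} ≤ c₀e^{−(δ′/2)R₁}e^{−(δ′/2)D}` (p02's `close_loc_of_decayFar` with threshold, prefactor and rate kept apart).
[cite: BalabanImbrieJaffe1988, (2.26) p.262] -/
theorem close_loc_of_decay3 {dist : α → β → ℝ} {ζ K : α → β → ℝ} {R₀ R₁ R₂ c₀ δ' : ℝ} (hc₀ : 0 ≤ c₀) (hδ' : 0 ≤ δ')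
    (hR : R₀ ≤ R₁) (hζ : IsCutoff dist ζ R₁ R₂) (h01 : ∀ a b, 0 ≤ ζ a b ∧ ζ a b ≤ 1)
    (hK : ∀ a b, R₀ ≤ dist a b → |K a b| ≤ c₀ * Real.exp (-δ' * dist a b)) :
    Close dist (loc ζ K) K (c₀ * Real.exp (-(δ' / 2) * R₁)) (δ' / 2) := by
  intro a b
  by_cases hab : dist a b ≤ R₁
  · have h1 := hζ.1 a b hab
    simp only [loc, h1, one_mul, sub_self, abs_zero]
    positivity
  · rw [not_le] at hab
    have hfac : |loc ζ K a b - K a b| ≤ |K a b| := by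
      have : loc ζ K a b - K a b = (ζ a b - 1) * K a b := by simp only [loc]; ring
      rw [this, abs_mul]
      have hz : |ζ a b - 1| ≤ 1 := by
        rw [abs_le]
        constructor <;> linarith [(h01 a b).1, (h01 a b).2]
      calc |ζ a b - 1| * |K a b| ≤ 1 * |K a b| := mul_le_mul_of_nonneg_right hz (abs_nonneg _)
        _ = |K a b| := one_mul _
    refine hfac.trans ((hK a b (by linarith)).trans ?_)
    rw [mul_assoc, ← Real.exp_add]
    refine mul_le_mul_of_nonneg_left (Real.exp_le_exp.2 ?_) hc₀
    nlinarith

end Mechanism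

/-! ## §2  (2.25)–(2.26) on the tori for the `C_k` of record, given only [6I] Proposition 1.2 -/

/-- the cutoff used is a (2.24) cutoff: p13's `cutoff (r/4) (r/2) dist` inhabits r18's `Zeta224 dist r` on the torus carriers
(`zeta224_cutoff`; any `r > 0`). [cite: BalabanImbrieJaffe1988, (2.24) p.262] -/
theorem zeta224_torus (k : ℕ) {r : ℝ} (hr : 0 < r) :
    Zeta224 (fun (x : TSite P 0) (b' : PBond P k) => distEU P k x b'.src) r
      (cutoff (r / 4) (r / 2) fun (x : TSite P 0) (b' : PBond P k) => distEU P k x b'.src) :=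
  zeta224_cutoff hr _

/-- **"Then C_{k,loc} also satisfies (2.23)" ON THE TORI FOR THE `C_k` OF RECORD, GIVEN ONLY [6I] PROPOSITION 1.2**: `∃ R₀ c₀ δ′, 0 < δ′ ∧
0 ≤ c₀ ∧` for EVERY `k ≤ m + K`, EVERY radius `r` and all `x, b′` with `dist(x,b′) ≥ R₀`: `|C_{k,loc}(x,b′)| ≤ c₀e^{−δ′dist(x,b′)}`,
`C_{k,loc} = loc ζ′_k C_k`, `ζ′_k = cutoff (r/4) (r/2) dist` ((2.23) for `C_k`: `BIJ88Decay223CkTorus.decay223_Ck_torus_prop12`; `0 ≤ ζ′_k ≤ 1`).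
[cite: BalabanImbrieJaffe1988, (2.25) p.262] -/
theorem decay223_CkLoc_torus_prop12 (hd : 2 ≤ P.d) {a : ℝ} (ha : 0 < a)
    (h12 : B5.Prop12Printed (fun i => settingOf (torusRep P (levStd P i) (deltaAData (levStd_le i) a)) i)) :
    ∃ R₀ c₀ δ' : ℝ, 0 < δ' ∧ 0 ≤ c₀ ∧ ∀ (k : ℕ) (hk : k ≤ P.m + P.K) (r : ℝ) (x : TSite P 0) (b' : PBond P k),
      R₀ ≤ distEU P k x b'.src →
        |loc (cutoff (r / 4) (r / 2) fun (x : TSite P 0) (b' : PBond P k) => distEU P k x b'.src)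
            (fun x b' => CkE P hd ((P.eta k) ^ P.d) ((P.L : ℝ) ^ k) k (toEj P k (Pi.single b' 1)) x) x b'| ≤
          c₀ * Real.exp (-δ' * distEU P k x b'.src) := by
  obtain ⟨R₀, c₀, δ', hδ', hc₀, h⟩ := decay223_Ck_torus_prop12 hd ha h12
  exact ⟨R₀, c₀, δ', hδ', hc₀, fun k hk r x b' hfar =>
    decay3_loc (fun x b' => ⟨cutoff_nonneg _ _ _ x b', cutoff_le_one _ _ _ x b'⟩) (fun x b' hxb => h k hk x b' hxb) x b' hfar⟩

/-- **(2.26) ON THE TORI FOR THE `C_k` OF RECORD, GIVEN ONLY [6I] PROPOSITION 1.2**: `∃ R₀ c₀ δ′, 0 < δ′ ∧ 0 ≤ c₀ ∧` for EVERY `k ≤ m + K`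
and EVERY radius `r ≥ 4R₀`: `Close dist C_{k,loc} C_k (c₀e^{−(δ′/2)(r/4)}) (δ′/2)`, i.e. `|C_{k,loc}(x,b′) − C_k(x,b′)| ≤ c₀e^{−(δ′/8)r}·
e^{−(δ′/2)dist(x,b′)}` for all `x, b′` — the printed `e^{−cr(e_k)}e^{−c dist}` at `r = r(e_k)`, cutoff `ζ′_k = cutoff (r/4) (r/2) dist`
(= 1 within `r/4`, (2.24)). [cite: BalabanImbrieJaffe1988, (2.26) p.262] -/
theorem close226_torus_prop12 (hd : 2 ≤ P.d) {a : ℝ} (ha : 0 < a)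
    (h12 : B5.Prop12Printed (fun i => settingOf (torusRep P (levStd P i) (deltaAData (levStd_le i) a)) i)) :
    ∃ R₀ c₀ δ' : ℝ, 0 < δ' ∧ 0 ≤ c₀ ∧ ∀ (k : ℕ) (hk : k ≤ P.m + P.K) (r : ℝ), 4 * R₀ ≤ r →
      Close (fun (x : TSite P 0) (b' : PBond P k) => distEU P k x b'.src)
        (loc (cutoff (r / 4) (r / 2) fun (x : TSite P 0) (b' : PBond P k) => distEU P k x b'.src)
          (fun x b' => CkE P hd ((P.eta k) ^ P.d) ((P.L : ℝ) ^ k) k (toEj P k (Pi.single b' 1)) x))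
        (fun x b' => CkE P hd ((P.eta k) ^ P.d) ((P.L : ℝ) ^ k) k (toEj P k (Pi.single b' 1)) x)
        (c₀ * Real.exp (-(δ' / 2) * (r / 4))) (δ' / 2) := by
  obtain ⟨R₀, c₀, δ', hδ', hc₀, h⟩ := decay223_Ck_torus_prop12 hd ha h12
  refine ⟨max R₀ 1, c₀, δ', hδ', hc₀, fun k hk r hr => ?_⟩
  have hr0 : 0 < r := by linarith [le_max_right R₀ 1]
  have hR : R₀ ≤ r / 4 := by linarith [le_max_left R₀ 1]
  exact close_loc_of_decay3 hc₀ hδ'.le hR (isCutoff_cutoff (by linarith) _)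
    (fun x b' => ⟨cutoff_nonneg _ _ _ x b', cutoff_le_one _ _ _ x b'⟩) (fun x b' hxb => h k hk x b' hxb)

/-- **ROW C2.Eq2.26's TYPED ONE-LETTER SHAPE FOR THE KERNEL OF RECORD** (p02's `close226` fed with p08's `decayFar223_Ck_torus_prop12`):
`∃ κ > 0, c > 0` such that for EVERY `k ≤ m + K` and every radius `r ≥ 4c` (`r > 0`), in the rescaled distance `dist′ = κ·dist`:
`Close dist′ (loc ζ′ C_k) C_k (ce^{−(c/2)(r/4)}) (c/2)` with `ζ′ = cutoff (r/4) (r/2) dist′` — given only `B5.Prop12Printed`.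
[cite: BalabanImbrieJaffe1988, (2.26) p.262] -/
theorem close226_torus_prop12_typed (hd : 2 ≤ P.d) {a : ℝ} (ha : 0 < a)
    (h12 : B5.Prop12Printed (fun i => settingOf (torusRep P (levStd P i) (deltaAData (levStd_le i) a)) i)) :
    ∃ κ c : ℝ, 0 < κ ∧ 0 < c ∧ ∀ (k : ℕ) (hk : k ≤ P.m + P.K) (r : ℝ), 0 < r → c ≤ r / 4 →
      Close (fun (x : TSite P 0) (b' : PBond P k) => κ * distEU P k x b'.src)
        (loc (cutoff (r / 4) (r / 2) fun (x : TSite P 0) (b' : PBond P k) => κ * distEU P k x b'.src)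
          (fun x b' => CkE P hd ((P.eta k) ^ P.d) ((P.L : ℝ) ^ k) k (toEj P k (Pi.single b' 1)) x))
        (fun x b' => CkE P hd ((P.eta k) ^ P.d) ((P.L : ℝ) ^ k) k (toEj P k (Pi.single b' 1)) x)
        (c * Real.exp (-(c / 2) * (r / 4))) (c / 2) := by
  obtain ⟨κ, c, hκ, hc, h⟩ := decayFar223_Ck_torus_prop12 hd ha h12
  exact ⟨κ, c, hκ, hc, fun k hk r hr hcr =>
    close226 hc.le hcr (zeta224_cutoff hr _) (fun x b' => ⟨cutoff_nonneg _ _ _ x b', cutoff_le_one _ _ _ x b'⟩) (h k hk)⟩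

end

end Literature.MathematicalPhysics.QuantumFieldTheory.BalabanImbrieJaffe1984to88.BIJ88CkLoc226Torus
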